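import Summits.MatrixMultiplication.OmegaCensus.DihC3SqSym

/-!
# ω-census, family (b3): the class `𝒞₂` — re-basing and sorting symmetries of the fibre model

HONEST FRAMING (pub-omega census; verbatim): lottery ticket; floor = certified bounds/negative ranges.
Census BOOKKEEPING (prereg P-031.3, session A); group-free; nothing here is progress on `ω`.

Re-basing `T ↦ T t₁⁻¹` (new labels `t₁⁻¹, t₂ t₁⁻¹`), `U ↦ U u₁⁻¹`, and the sorting swaps `t₁ ↔ t₂`, `u₁ ↔ u₂` move `Bound16`
FORWARD (`bound16_rebT`, `bound16_rebU`, `bound16_srtT`, `bound16_srtU`): after the position permutation the coordinate `d`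
is multiplied by the sign of `t₁` (resp. `u₁`), resp. unchanged, so `bound16_transport` applies with `A = ±1`.
-/

open Finset

namespace Summit.MatrixMultiplication.OmegaCensus.DihC3Sq

open CentreIndexSix IndepSearch

/-! ## Re-basing and sorting -/

/-- Product of labels in `Dih(F₃²)`: `(k, e)(k', e') = (k + e k', e e')`. [folklore] -/
def mulLab (l l' : ℕ) : ℕ :=
  (l % 3 + (if l < 9 then 1 else 2) * (l' % 3)) % 3 + 3 * ((l / 3 % 3 + (if l < 9 then 1 else 2) * (l' / 3 % 3)) % 3) +
    9 * ((l / 9 + l' / 9) % 2)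

/-- Inverse of a label: rotations `k ↦ −k`, reflections are involutions. [folklore] -/
def invLab (l : ℕ) : ℕ := if l < 9 then (3 - l % 3) % 3 + 3 * ((3 - l / 3 % 3) % 3) else l

/-- Products of labels are labels (`< 18`). [folklore] -/
theorem mulLab_lt (l l' : ℕ) : mulLab l l' < 18 := by unfold mulLab; split_ifs <;> omega
/-- Inverses of labels are labels (`< 18`). [folklore] -/
theorem invLab_lt {l : ℕ} (hl : l < 18) : invLab l < 18 := by unfold invLab; split_ifs <;> omega

/-- Signs are `±1`. [folklore] -/
theorem sg_cases (l : ℕ) : sg l = 1 ∨ sg l = -1 := by unfold sg; split_ifs <;> simp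

/-- `sg l ^ 2 = 1`. [folklore] -/
theorem sg_mul_self (l : ℕ) : sg l * sg l = 1 := by rcases sg_cases l with h | h <;> rw [h] <;> decide

/-- The product read in vectors and signs. [folklore] -/
theorem vec_mulLab {l l' : ℕ} (hl : l < 18) (hl' : l' < 18) :
    vec (mulLab l l') = vec l + sg l • vec l' ∧ sg (mulLab l l') = sg l * sg l' := by
  have h0 : mulLab l l' % 3 = (l % 3 + (if l < 9 then 1 else 2) * (l' % 3)) % 3 := by unfold mulLab; split_ifs <;> omega
  have h1 : mulLab l l' / 3 % 3 = (l / 3 % 3 + (if l < 9 then 1 else 2) * (l' / 3 % 3)) % 3 := by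
    unfold mulLab; split_ifs <;> omega
  have h9 : mulLab l l' < 9 ↔ (l / 9 + l' / 9) % 2 = 0 := by unfold mulLab; split_ifs <;> omega
  refine ⟨?_, ?_⟩
  · by_cases hs : l < 9
    · have e : sg l = 1 := by simp [sg, hs]
      ext
      · simp only [vec, h0, if_pos hs, one_mul, ZMod.natCast_mod, Nat.cast_add, Prod.fst_add, e, one_smul]
      · simp only [vec, h1, if_pos hs, one_mul, ZMod.natCast_mod, Nat.cast_add, Prod.snd_add, e, one_smul]
    · have e : sg l = -1 := by simp [sg, hs]
      ext
      · simp only [vec, h0, if_neg hs, ZMod.natCast_mod, Nat.cast_add, Nat.cast_mul, Prod.fst_add, Prod.smul_fst, e,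
          smul_eq_mul]
        rw [show ((2 : ℕ) : ZMod 3) = -1 from rfl]
      · simp only [vec, h1, if_neg hs, ZMod.natCast_mod, Nat.cast_add, Nat.cast_mul, Prod.snd_add, Prod.smul_snd, e,
          smul_eq_mul]
        rw [show ((2 : ℕ) : ZMod 3) = -1 from rfl]
  · by_cases a : l < 9 <;> by_cases b : l' < 9
    · have hc : (l / 9 + l' / 9) % 2 = 0 := by omega
      simp [sg, h9, hc, a, b]
    · have hc : ¬ (l / 9 + l' / 9) % 2 = 0 := by omega
      simp [sg, h9, hc, a, b]
    · have hc : ¬ (l / 9 + l' / 9) % 2 = 0 := by omega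
      simp [sg, h9, hc, a, b]
    · have hc : (l / 9 + l' / 9) % 2 = 0 := by omega
      simp [sg, h9, hc, a, b]

/-- The inverse read in vectors and signs. [folklore] -/
theorem vec_invLab (l : ℕ) : vec (invLab l) = -(sg l) • vec l ∧ sg (invLab l) = sg l := by
  by_cases hs : l < 9
  · have e : sg l = 1 := by simp [sg, hs]
    have h0 : invLab l % 3 = (3 - l % 3) % 3 := by unfold invLab; rw [if_pos hs]; omega
    have h1 : invLab l / 3 % 3 = (3 - l / 3 % 3) % 3 := by unfold invLab; rw [if_pos hs]; omega
    have h9 : invLab l < 9 := by unfold invLab; rw [if_pos hs]; omega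
    refine ⟨?_, by simp [sg, h9, hs]⟩
    have c3 : ∀ x : ℕ, x < 3 → (((3 - x) % 3 : ℕ) : ZMod 3) = -((x : ℕ) : ZMod 3) := by decide
    ext
    · simp only [vec, h0, e, Prod.smul_mk, smul_eq_mul, neg_one_mul]; exact c3 _ (Nat.mod_lt _ (by norm_num))
    · simp only [vec, h1, e, Prod.smul_mk, smul_eq_mul, neg_one_mul]; exact c3 _ (Nat.mod_lt _ (by norm_num))
  · have e : sg l = -1 := by simp [sg, hs]
    have hi : invLab l = l := by unfold invLab; rw [if_neg hs]
    rw [hi, e]; simp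

/-- Swap of the indices `0` and `1`. [folklore] -/
def swap01 (i : ℕ) : ℕ := if i = 0 then 1 else if i = 1 then 0 else i
/-- Swap of the indices `1` and `2`. [folklore] -/
def swap12 (i : ℕ) : ℕ := if i = 1 then 2 else if i = 2 then 1 else i
/-- A map of `T`-indices acting on positions `p = 3 i + j`. [folklore] -/
def pmapT (f : ℕ → ℕ) (p : ℕ) : ℕ := 3 * f (p / 3) + p % 3
/-- A map of `U`-indices acting on positions. [folklore] -/
def pmapU (f : ℕ → ℕ) (p : ℕ) : ℕ := 3 * (p / 3) + f (p % 3)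

/-- Re-basing `T ↦ T t₁⁻¹`: new labels `(t₁⁻¹, t₂ t₁⁻¹)`. [folklore] -/
def rebT (n : ℕ) : ℕ := cfgOf4 (invLab (n % 18)) (mulLab (n / 18 % 18) (invLab (n % 18))) (n / 324 % 18) (n / 5832 % 18)
/-- Re-basing `U ↦ U u₁⁻¹`. [folklore] -/
def rebU (n : ℕ) : ℕ := cfgOf4 (n % 18) (n / 18 % 18) (invLab (n / 324 % 18)) (mulLab (n / 5832 % 18) (invLab (n / 324 % 18)))
/-- Sorting swap `t₁ ↔ t₂`. [folklore] -/
def srtT (n : ℕ) : ℕ := cfgOf4 (n / 18 % 18) (n % 18) (n / 324 % 18) (n / 5832 % 18)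
/-- Sorting swap `u₁ ↔ u₂`. [folklore] -/
def srtU (n : ℕ) : ℕ := cfgOf4 (n % 18) (n / 18 % 18) (n / 5832 % 18) (n / 324 % 18)

/-- Abstract form of the re-basing identity: multiplying the two `T`-labels on the right by `g` leaves `B` unchanged and
multiplies `d` by the sign of `g`. [folklore] -/
theorem reb_master (vt vt' vu vu' G : ZMod 3 × ZMod 3) {st st' su su' sgg : ZMod 3}
    (h1 : st = 1 ∨ st = -1) (h2 : st' = 1 ∨ st' = -1) (hg : sgg = 1 ∨ sgg = -1) :
    -(st' * sgg * su') • ((vt + st • G) - (st * sgg * (st' * sgg)) • (vt' + st' • G) +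
        (st * sgg * (st' * sgg)) • (vu - (su * su') • vu')) =
      mv sgg 0 0 sgg (-(st' * su') • (vt - (st * st') • vt' + (st * st') • (vu - (su * su') • vu'))) := by
  rcases h1 with r1 | r1 <;> rcases h2 with r2 | r2 <;> rcases hg with r3 | r3 <;> subst r1 r2 r3 <;> ext <;>
    simp only [mv, Prod.fst_add, Prod.snd_add, Prod.fst_sub, Prod.snd_sub, Prod.smul_fst,
      Prod.smul_snd, smul_eq_mul, zero_mul, add_zero, zero_add] <;> ring

/-- The same for the `U`-labels. [folklore] -/
theorem rebU_master (vt vt' vu vu' G : ZMod 3 × ZMod 3) {st st' su su' sgg : ZMod 3}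
    (h3 : su = 1 ∨ su = -1) (h4 : su' = 1 ∨ su' = -1) (hg : sgg = 1 ∨ sgg = -1) :
    -(st' * (su' * sgg)) • (vt - (st * st') • vt' + (st * st') • ((vu + su • G) - (su * sgg * (su' * sgg)) • (vu' + su' • G))) =
      mv sgg 0 0 sgg (-(st' * su') • (vt - (st * st') • vt' + (st * st') • (vu - (su * su') • vu'))) := by
  rcases h3 with r1 | r1 <;> rcases h4 with r2 | r2 <;> rcases hg with r3 | r3 <;> subst r1 r2 r3 <;> ext <;>
    simp only [mv, Prod.fst_add, Prod.snd_add, Prod.fst_sub, Prod.snd_sub, Prod.smul_fst,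
      Prod.smul_snd, smul_eq_mul, zero_mul, add_zero, zero_add] <;> ring

/-- `T`-index of a `T`-mapped position. [folklore] -/
theorem pmapT_div (f : ℕ → ℕ) (p : ℕ) : pmapT f p / 3 = f (p / 3) := by unfold pmapT; omega
/-- `U`-index of a `T`-mapped position. [folklore] -/
theorem pmapT_mod (f : ℕ → ℕ) (p : ℕ) : pmapT f p % 3 = p % 3 := by unfold pmapT; omega
/-- `T`-index of a `U`-mapped position. [folklore] -/
theorem pmapU_div (f : ℕ → ℕ) (hf : ∀ j < 3, f j < 3) (p : ℕ) : pmapU f p / 3 = p / 3 := by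
  have := hf (p % 3) (Nat.mod_lt _ (by norm_num)); unfold pmapU; omega
/-- `U`-index of a `U`-mapped position. [folklore] -/
theorem pmapU_mod (f : ℕ → ℕ) (hf : ∀ j < 3, f j < 3) (p : ℕ) : pmapU f p % 3 = f (p % 3) := by
  have := hf (p % 3) (Nat.mod_lt _ (by norm_num)); unfold pmapU; omega
/-- `swap01` preserves indices `< 3`. [folklore] -/
theorem swap01_lt3 (i : ℕ) (hi : i < 3) : swap01 i < 3 := by unfold swap01; split_ifs <;> omega
/-- `swap12` preserves indices `< 3`. [folklore] -/
theorem swap12_lt3 (i : ℕ) (hi : i < 3) : swap12 i < 3 := by unfold swap12; split_ifs <;> omega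
/-- `swap01` is injective. [folklore] -/
theorem swap01_inj {i i' : ℕ} (h : swap01 i = swap01 i') : i = i' := by unfold swap01 at h; split_ifs at h <;> omega
/-- `swap12` is injective. [folklore] -/
theorem swap12_inj {i i' : ℕ} (h : swap12 i = swap12 i') : i = i' := by unfold swap12 at h; split_ifs at h <;> omega

/-- `T`-mapped positions are positions (`< 9`). [folklore] -/
theorem pmapT_lt9 {f : ℕ → ℕ} (hf : ∀ i < 3, f i < 3) (p : ℕ) (hp : p < 9) : pmapT f p < 9 := by
  have := hf (p / 3) (by omega); unfold pmapT; omega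
/-- `U`-mapped positions are positions (`< 9`). [folklore] -/
theorem pmapU_lt9 {f : ℕ → ℕ} (hf : ∀ j < 3, f j < 3) (p : ℕ) (hp : p < 9) : pmapU f p < 9 := by
  have := hf (p % 3) (Nat.mod_lt _ (by norm_num)); unfold pmapU; omega
/-- `pmapT f` is injective for injective `f`. [folklore] -/
theorem pmapT_inj {f : ℕ → ℕ} (hf : ∀ i i', f i = f i' → i = i') {p q : ℕ} (h : pmapT f p = pmapT f q) : p = q := by
  unfold pmapT at h; have := hf (p / 3) (q / 3) (by omega); omega
/-- `pmapU f` is injective for injective `f`. [folklore] -/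
theorem pmapU_inj {f : ℕ → ℕ} (hf3 : ∀ j < 3, f j < 3) (hf : ∀ i i', f i = f i' → i = i') {p q : ℕ}
    (h : pmapU f p = pmapU f q) : p = q := by
  unfold pmapU at h; have := hf3 (p % 3) (Nat.mod_lt _ (by norm_num)); have := hf3 (q % 3) (Nat.mod_lt _ (by norm_num))
  have := hf (p % 3) (q % 3) (by omega); omega

/-- The identity matrix acts trivially. [folklore] -/
theorem mv_one (x : ZMod 3 × ZMod 3) : mv 1 0 0 1 x = x := by ext <;> simp [mv]
/-- `±1` is an involution. [folklore] -/
theorem mv_sgn_invol {s : ZMod 3} (hs : s = 1 ∨ s = -1) (x : ZMod 3 × ZMod 3) : mv s 0 0 s (mv s 0 0 s x) = x := by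
  rcases hs with rfl | rfl <;> ext <;> simp [mv]
/-- `±1` is invertible. [folklore] -/
theorem sgn_det {s : ZMod 3} (hs : s = 1 ∨ s = -1) : s * s - 0 * 0 ≠ 0 := by rcases hs with rfl | rfl <;> decide

/-! ### The labels of the re-based / sorted configurations -/

/-- The `T`-labels of a configuration. [folklore] -/
theorem labT_vals (n : ℕ) : labT n 0 = 0 ∧ labT n 1 = n % 18 ∧ labT n 2 = n / 18 % 18 := by simp [labT]
/-- The `U`-labels of a configuration. [folklore] -/
theorem labU_vals (n : ℕ) : labU n 0 = 0 ∧ labU n 1 = n / 324 % 18 ∧ labU n 2 = n / 5832 % 18 := by simp [labU]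

/-- The labels of `rebT n`. [folklore] -/
theorem rebT_vals (n : ℕ) : labT (rebT n) 0 = 0 ∧ labT (rebT n) 1 = invLab (n % 18) ∧
    labT (rebT n) 2 = mulLab (n / 18 % 18) (invLab (n % 18)) ∧ ∀ j, labU (rebT n) j = labU n j := by
  have h1 := invLab_lt (Nat.mod_lt n (by norm_num : 0 < 18))
  have h2 := mulLab_lt (n / 18 % 18) (invLab (n % 18))
  refine ⟨by simp [labT], by rw [rebT, labT_cfgOf4 h1 h2]; simp, by rw [rebT, labT_cfgOf4 h1 h2]; simp, fun j => ?_⟩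
  rw [rebT, labU_cfgOf4 h1 h2 (Nat.mod_lt _ (by norm_num)) (Nat.mod_lt _ (by norm_num))]; simp [labU]

/-- The labels of `rebU n`. [folklore] -/
theorem rebU_vals (n : ℕ) : labU (rebU n) 0 = 0 ∧ labU (rebU n) 1 = invLab (n / 324 % 18) ∧
    labU (rebU n) 2 = mulLab (n / 5832 % 18) (invLab (n / 324 % 18)) ∧ ∀ i, labT (rebU n) i = labT n i := by
  have h1 := invLab_lt (Nat.mod_lt (n / 324) (by norm_num : 0 < 18))
  have h2 := mulLab_lt (n / 5832 % 18) (invLab (n / 324 % 18))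
  have h3 : n % 18 < 18 := Nat.mod_lt _ (by norm_num)
  have h4 : n / 18 % 18 < 18 := Nat.mod_lt _ (by norm_num)
  refine ⟨by simp [labU], by rw [rebU, labU_cfgOf4 h3 h4 h1 h2]; simp, by rw [rebU, labU_cfgOf4 h3 h4 h1 h2]; simp,
    fun i => ?_⟩
  rw [rebU, labT_cfgOf4 h3 h4]; simp [labT]

/-- The labels of `srtT n`. [folklore] -/
theorem srtT_vals (n : ℕ) : (∀ i < 3, labT (srtT n) i = labT n (swap12 i)) ∧ ∀ j, labU (srtT n) j = labU n j := by
  have h3 : n % 18 < 18 := Nat.mod_lt _ (by norm_num)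
  have h4 : n / 18 % 18 < 18 := Nat.mod_lt _ (by norm_num)
  refine ⟨fun i hi => ?_, fun j => ?_⟩
  · rw [srtT, labT_cfgOf4 h4 h3]; unfold labT swap12; interval_cases i <;> simp
  · rw [srtT, labU_cfgOf4 h4 h3 (Nat.mod_lt _ (by norm_num)) (Nat.mod_lt _ (by norm_num))]; simp [labU]

/-- The labels of `srtU n`. [folklore] -/
theorem srtU_vals (n : ℕ) : (∀ j < 3, labU (srtU n) j = labU n (swap12 j)) ∧ ∀ i, labT (srtU n) i = labT n i := by
  have h3 : n % 18 < 18 := Nat.mod_lt _ (by norm_num)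
  have h4 : n / 18 % 18 < 18 := Nat.mod_lt _ (by norm_num)
  refine ⟨fun j hj => ?_, fun i => ?_⟩
  · rw [srtU, labU_cfgOf4 h3 h4 (Nat.mod_lt _ (by norm_num)) (Nat.mod_lt _ (by norm_num))]
    unfold labU swap12; interval_cases j <;> simp
  · rw [srtU, labT_cfgOf4 h3 h4]; simp [labT]

/-- The three `T`-label facts of re-basing, as a finite check over `t₁, t₂`. [folklore] -/
theorem reb_facts : ∀ t1 : ℕ, t1 < 18 → ∀ t2 : ℕ, t2 < 18 →
    (vec 0 = vec t1 + sg t1 • vec (invLab t1) ∧ sg 0 = sg t1 * sg t1) ∧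
      (vec (invLab t1) = vec 0 + sg 0 • vec (invLab t1) ∧ sg (invLab t1) = sg 0 * sg t1) ∧
        (vec (mulLab t2 (invLab t1)) = vec t2 + sg t2 • vec (invLab t1) ∧ sg (mulLab t2 (invLab t1)) = sg t2 * sg t1) := by
  decide

/-- Re-based `T`-labels in vectors and signs: the new label at index `i` is the old label at `swap01 i` times `t₁⁻¹`.
[folklore] -/
theorem labT_rebT (n : ℕ) : ∀ i < 3,
    vec (labT (rebT n) i) = vec (labT n (swap01 i)) + sg (labT n (swap01 i)) • vec (invLab (labT n 1)) ∧
      sg (labT (rebT n) i) = sg (labT n (swap01 i)) * sg (labT n 1) := by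
  obtain ⟨r0, r1, r2, -⟩ := rebT_vals n
  obtain ⟨l0, l1, l2⟩ := labT_vals n
  obtain ⟨f0, f1, f2⟩ := reb_facts (n % 18) (Nat.mod_lt _ (by norm_num)) (n / 18 % 18) (Nat.mod_lt _ (by norm_num))
  intro i hi
  interval_cases i
  · rw [show swap01 0 = 1 from rfl, r0, l1]; exact f0
  · rw [show swap01 1 = 0 from rfl, r1, l0, l1]; exact f1
  · rw [show swap01 2 = 2 from rfl, r2, l2, l1]; exact f2

/-- Auxiliary lemma `labU_rebU`. [folklore] -/
theorem labU_rebU (n : ℕ) : ∀ j < 3,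
    vec (labU (rebU n) j) = vec (labU n (swap01 j)) + sg (labU n (swap01 j)) • vec (invLab (labU n 1)) ∧
      sg (labU (rebU n) j) = sg (labU n (swap01 j)) * sg (labU n 1) := by
  obtain ⟨r0, r1, r2, -⟩ := rebU_vals n
  obtain ⟨l0, l1, l2⟩ := labU_vals n
  obtain ⟨f0, f1, f2⟩ := reb_facts (n / 324 % 18) (Nat.mod_lt _ (by norm_num)) (n / 5832 % 18) (Nat.mod_lt _ (by norm_num))
  intro j hj
  interval_cases j
  · rw [show swap01 0 = 1 from rfl, r0, l1]; exact f0
  · rw [show swap01 1 = 0 from rfl, r1, l0, l1]; exact f1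
  · rw [show swap01 2 = 2 from rfl, r2, l2, l1]; exact f2

/-! ### The `d`-identities and the transports -/

/-- `d` after re-basing `T`: the old `d` at the swapped positions times the sign of `t₁`. [folklore] -/
theorem dv_rebT (n p q : ℕ) (hp : p < 9) (hq : q < 9) :
    dv (rebT n) p q = mv (sg (labT n 1)) 0 0 (sg (labT n 1)) (dv n (pmapT swap01 p) (pmapT swap01 q)) := by
  rw [dv_formula, dv_formula, pmapT_div, pmapT_div, pmapT_mod, pmapT_mod, (rebT_vals n).2.2.2, (rebT_vals n).2.2.2]
  obtain ⟨v1, s1⟩ := labT_rebT n (p / 3) (by omega)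
  obtain ⟨v2, s2⟩ := labT_rebT n (q / 3) (by omega)
  rw [v1, v2, s1, s2]
  exact reb_master _ _ _ _ _ (sg_cases _) (sg_cases _) (sg_cases _)

/-- `d` after re-basing `U`: the old `d` at the swapped positions times the sign of `u₁`. [folklore] -/
theorem dv_rebU (n p q : ℕ) :
    dv (rebU n) p q = mv (sg (labU n 1)) 0 0 (sg (labU n 1)) (dv n (pmapU swap01 p) (pmapU swap01 q)) := by
  rw [dv_formula, dv_formula, pmapU_div _ swap01_lt3, pmapU_div _ swap01_lt3, pmapU_mod _ swap01_lt3,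
    pmapU_mod _ swap01_lt3, (rebU_vals n).2.2.2, (rebU_vals n).2.2.2]
  obtain ⟨v1, s1⟩ := labU_rebU n (p % 3) (by omega)
  obtain ⟨v2, s2⟩ := labU_rebU n (q % 3) (by omega)
  rw [v1, v2, s1, s2]
  exact rebU_master _ _ _ _ _ (sg_cases _) (sg_cases _) (sg_cases _)

/-- `d` after sorting `T`: the old `d` at the swapped positions. [folklore] -/
theorem dv_srtT (n p q : ℕ) (hp : p < 9) (hq : q < 9) : dv (srtT n) p q = dv n (pmapT swap12 p) (pmapT swap12 q) := by
  rw [dv_formula, dv_formula, pmapT_div, pmapT_div, pmapT_mod, pmapT_mod, (srtT_vals n).2, (srtT_vals n).2,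
    (srtT_vals n).1 _ (by omega), (srtT_vals n).1 _ (by omega)]

/-- `d` after sorting `U`: the old `d` at the swapped positions. [folklore] -/
theorem dv_srtU (n p q : ℕ) : dv (srtU n) p q = dv n (pmapU swap12 p) (pmapU swap12 q) := by
  rw [dv_formula, dv_formula, pmapU_div _ swap12_lt3, pmapU_div _ swap12_lt3, pmapU_mod _ swap12_lt3,
    pmapU_mod _ swap12_lt3, (srtU_vals n).2, (srtU_vals n).2, (srtU_vals n).1 _ (by omega), (srtU_vals n).1 _ (by omega)]

/-- **`Bound16` moves along re-basing of `T`.** [folklore] -/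
theorem bound16_rebT (n : ℕ) : Bound16 n → Bound16 (rebT n) := by
  refine bound16_transport (pmapT swap01) (pmapT_lt9 swap01_lt3) (fun p _ q _ h => pmapT_inj (fun _ _ => swap01_inj) h)
    (sg (labT n 1)) 0 0 (sg (labT n 1)) (sgn_det (sg_cases _)) (fun _ => 0) fun p hp q hq _ => ?_
  rw [dv_rebT n p q hp hq, mv_sgn_invol (sg_cases _), add_zero, sub_zero]

/-- **`Bound16` moves along re-basing of `U`.** [folklore] -/
theorem bound16_rebU (n : ℕ) : Bound16 n → Bound16 (rebU n) := by
  refine bound16_transport (pmapU swap01) (pmapU_lt9 swap01_lt3) (fun p _ q _ h =>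
    pmapU_inj swap01_lt3 (fun _ _ => swap01_inj) h) (sg (labU n 1)) 0 0 (sg (labU n 1)) (sgn_det (sg_cases _))
    (fun _ => 0) fun p _ q _ _ => ?_
  rw [dv_rebU n p q, mv_sgn_invol (sg_cases _), add_zero, sub_zero]

/-- **`Bound16` moves along sorting of `T`.** [folklore] -/
theorem bound16_srtT (n : ℕ) : Bound16 n → Bound16 (srtT n) := by
  refine bound16_transport (pmapT swap12) (pmapT_lt9 swap12_lt3) (fun p _ q _ h => pmapT_inj (fun _ _ => swap12_inj) h)
    1 0 0 1 (by decide) (fun _ => 0) fun p hp q hq _ => ?_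
  rw [dv_srtT n p q hp hq, mv_one, add_zero, sub_zero]

/-- **`Bound16` moves along sorting of `U`.** [folklore] -/
theorem bound16_srtU (n : ℕ) : Bound16 n → Bound16 (srtU n) := by
  refine bound16_transport (pmapU swap12) (pmapU_lt9 swap12_lt3) (fun p _ q _ h =>
    pmapU_inj swap12_lt3 (fun _ _ => swap12_inj) h) 1 0 0 1 (by decide) (fun _ => 0) fun p _ q _ _ => ?_
  rw [dv_srtU n p q, mv_one, add_zero, sub_zero]

end Summit.MatrixMultiplication.OmegaCensus.DihC3Sq
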